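import Mathlib
import Summits.Schanuel.Schanuel.Statement
import Literature.NumberTheory.Transcendental.RoyCriterion
import Literature.NumberTheory.Transcendental.RoyCriterionProofs
import Literature.NumberTheory.Transcendental.RoyCriterionProp3Proofs
import Literature.NumberTheory.Transcendental.RoyCriterionProp2Proofs
import Summits.Schanuel.Schanuel.Theorems.SoloBlindPadeNormalForm
import Summits.Schanuel.Schanuel.Theorems.SoloBlindHermitePerfect
import HarnessLib

/-!
# The Padé existence exponent: Roy's equivalence without the Siegel ceiling

`Summits/Schanuel/Schanuel/Theorems/SoloBlindPadeExponent.lean` (soloist `solo-Schanuel-blind`,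
session 15).

Roy (Acta Arith. 97 (2001)) proved `SchanuelRank l ⟺ RoyCriterion l` for every parameter tuple in
the window (1): `max{1,t₀,2t₁} < min{s₀,2s₁}`, `max{s₀, s₁+t₁} < u < ½(1+t₀+t₁)`, and notes (p. 190)
that each half of his Theorem 1 "assumes a weaker condition than (1)": the CEILING
`u < ½(1+t₀+t₁)` enters only through Waldschmidt's auxiliary construction (Siegel's lemma), never
through the interpolation estimate (Proposition 3, range `max{1,t₀,2t₁} < min{s₀,2s₁} < u`, proved
in the tree as `Roy2001_prop3_holds`).  This file separates the two roles.  Say PADÉ FORMS EXIST AT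
EXPONENT `v` if for all large `N` some non-zero `P ∈ ℤ[X₀,X₁]`, `deg ≤ (N^{t₀}, N^{t₁})`,
`H(P) ≤ e^N`, has `taylorInt n P = 0` for all `n ≤ N^v` (written out in full below; no definitions).

* `royCriterionAt_of_schanuelRank` — `SchanuelRank l` implies the criterion at EVERY tuple of
  Proposition 3's range: no ceiling on `u` (Roy's §5, 1° run with Proposition 3).
* `royHypothesis_exp_of_padeExponent`, `schanuelRank_of_royCriterionAt`,
  `schanuelRank_iff_royCriterionAt` — if Padé forms exist at exponent `v`, the criterion at any
  tuple with `0 < s₀ < u`,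
  `max{1, t₀, s₁+t₁, u} < v` implies `SchanuelRank l` (the tree's `universal_of_pade` + Cauchy);
  hence ROY'S EQUIVALENCE HOLDS AT EVERY TUPLE OF PROPOSITION 3'S RANGE BELOW THE PADÉ EXISTENCE
  EXPONENT `v*(t₀,t₁) = sup{v : Padé forms exist at v}` — the ceiling is replaced by `v*`.
* `exists_pade_of_lt_half` — `v* ≥ ½(1+t₀+t₁)` (Siegel, via `exists_padeSequence`), recovering Roy's
  theorem tuple by tuple (`schanuelRank_iff_royCriterionAt_of_admissible`);
  `eventually_exists_taylorInt_ne_zero_of_lt` — `v* ≤ t₀+t₁` (Hermite perfectness,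
  `SoloBlindHermitePerfect`); `not_royHypothesis_of_lt`, `royCriterionAt_of_lt_s₀` — for
  `s₀ > t₀+t₁` the hypothesis fails at EVERY point (`m = 0`: the integers `taylorInt k P_N`,
  `k ≤ N^{s₀}`, would vanish), so there the criterion holds vacuously in every rank.
* `royHypothesis_anti_exponent` — the hypothesis strengthens with `u`, so the criterion weakens
  formally as `u` grows; its weakest form still equivalent to Schanuel is the one at `u → v*⁻`.

Upshot (wall.md §2, §4 R-A9): the free smallness parameter of Roy's strategy is the Diophantine
exponent `v*(t₀,t₁) ∈ [½(1+t₀+t₁), t₀+t₁]` of the integer Hermite–Padé problem for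
`(1, e^w, …, e^{⌊N^{t₁}⌋w})` with coefficients of degree `≤ N^{t₀}` and height `≤ e^N`; whether
`v* > ½(1+t₀+t₁)` — whether the Padé lattices of `exp` carry vectors exponentially shorter than the
Bombieri–Vaaler guarantee — is exactly whether Roy's window can be widened (measured at finite size
in `work/pade_lattice/`, job ids in `CLAIMS.jsonl`).

References: D. Roy, *An arithmetic criterion for the values of the exponential function*, Acta
Arith. 97 (2001) 183–194 (Conj. 2, Thm. 1, Props. 2–3, §5, p. 190); M. Waldschmidt, Invent. Math.
63 (1981) 97–127, Thm. 3.1; E. Bombieri, J. Vaaler, *On Siegel's lemma*, Invent. Math. 73 (1983)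
11–32; C. Hermite, *Sur la fonction exponentielle*, C. R. Acad. Sci. Paris 77 (1873).
-/

noncomputable section

open Filter Complex MvPolynomial Metric

namespace Summit.Schanuel.Schanuel.Theorems

open Literature.NumberTheory.Transcendental

/-! ### Schanuel ⇒ the criterion, with no ceiling on `u` -/

/-- The transcendence-degree step of Roy 2001, §5, 1°, isolated: if every `α_j e^{-y_j}` is a
root of unity (`RoyConditionA (y j) (α j)`), `y` is `ℚ`-linearly independent and Schanuel's
conjecture holds in rank `l`, then `trdeg_ℚ ℚ(y, α) ≥ l` (pass to `(Dy, α^D) = (Dy, e^{Dy})`,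
`D = ∏ d_j`). [cite: Roy2001, §5 (1°)] -/
theorem le_trdeg_of_royConditionA {l : ℕ} {y α : Fin l → ℂ} (hy : LinearIndependent ℚ y)
    (hd : ∀ j, RoyConditionA (y j) (α j)) (hS : SchanuelRank l) :
    (l : Cardinal) ≤ Algebra.trdeg ℚ
      ↥(IntermediateField.adjoin ℚ (Set.range y ∪ Set.range α)) := by
  choose d hd1 hd2 using hd
  set D : ℕ := ∏ j, d j with hD
  have hD0 : 0 < D := Finset.prod_pos fun j _ => hd1 j
  have hαD : ∀ j, α j ^ D = cexp (D * y j) := by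
    intro j
    obtain ⟨e, he⟩ : d j ∣ D := Finset.dvd_prod_of_mem _ (Finset.mem_univ j)
    rw [he, pow_mul, hd2 j, ← Complex.exp_nat_mul]
    push_cast; ring_nf
  set y' : Fin l → ℂ := fun j => (D : ℂ) * y j with hy'_def
  have hy' : LinearIndependent ℚ y' := by
    have hDq : (D : ℚ) ≠ 0 := by exact_mod_cast hD0.ne'
    have := hy.units_smul (fun _ => Units.mk0 (D : ℚ) hDq)
    convert this using 1
    ext j
    simp [hy'_def, Units.smul_def, Rat.smul_def]
  have hle : IntermediateField.adjoin ℚ (Set.range y' ∪ Set.range (cexp ∘ y')) ≤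
      IntermediateField.adjoin ℚ (Set.range y ∪ Set.range α) := by
    refine IntermediateField.adjoin_le_iff.mpr ?_
    rintro x (⟨j, rfl⟩ | ⟨j, rfl⟩)
    · exact mul_mem (natCast_mem _ D)
        (IntermediateField.subset_adjoin _ _ (Or.inl ⟨j, rfl⟩))
    · change cexp ((D : ℂ) * y j) ∈ _
      rw [← hαD j]
      exact pow_mem (IntermediateField.subset_adjoin ℚ (Set.range y ∪ Set.range α)
        (Or.inr ⟨j, rfl⟩)) D
  calc (l : Cardinal)
      ≤ Algebra.trdeg ℚ ↥(IntermediateField.adjoin ℚ (Set.range y' ∪ Set.range (cexp ∘ y'))) :=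
        hS y' hy'
    _ ≤ Algebra.trdeg ℚ ↥(IntermediateField.adjoin ℚ (Set.range y ∪ Set.range α)) :=
        trdeg_le_of_injective (IntermediateField.inclusion hle)
          (IntermediateField.inclusion_injective hle)

/-- **Schanuel in rank `l` implies Roy's criterion at every parameter tuple of Proposition 3's
range — no upper bound on `u`.**  For positive `s₀, s₁, t₀, t₁, u` with
`max{1, t₀, 2t₁} < min{s₀, 2s₁} < u` (and NO condition `u < ½(1+t₀+t₁)`), `ℚ`-linearly independent
`y`, non-zero `α_j` and Roy's hypothesis for `(y, α)` at these parameters, `trdeg_ℚ ℚ(y, α) ≥ l`.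
(Proposition 3 — proved in the tree, `Roy2001_prop3_holds` — gives `(b) ⇒ (a)` in this range;
then `le_trdeg_of_royConditionA`.)  The ceiling of Roy's window is therefore used only in the
converse direction. [this work; cite: Roy2001, Prop. 3, §5 (1°)] -/
theorem royCriterionAt_of_schanuelRank {l : ℕ} (hS : SchanuelRank l) {s₀ s₁ t₀ t₁ u : ℝ}
    (hs₀ : 0 < s₀) (hs₁ : 0 < s₁) (ht₀ : 0 < t₀) (ht₁ : 0 < t₁) (hu : 0 < u)
    (h1 : max 1 (max t₀ (2 * t₁)) < min s₀ (2 * s₁)) (h2 : min s₀ (2 * s₁) < u)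
    (y α : Fin l → ℂ) (hy : LinearIndependent ℚ y) (hα : ∀ j, α j ≠ 0)
    (hhyp : RoyHypothesis y α s₀ s₁ t₀ t₁ u) :
    (l : Cardinal) ≤ Algebra.trdeg ℚ
      ↥(IntermediateField.adjoin ℚ (Set.range y ∪ Set.range α)) := by
  refine le_trdeg_of_royConditionA hy (fun j => ?_) hS
  by_contra ha
  exact Roy2001_prop3_holds (y j) (α j) (hα j) s₀ s₁ t₀ t₁ u hs₀ hs₁ ht₀ ht₁ hu h1 h2 ha
    (royConditionB_of_royHypothesis hhyp j)

/-- **Monotonicity in the smallness exponent.**  Roy's hypothesis at `u` implies Roy's hypothesis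
at every `u' ≤ u` (same polynomials); consequently the criterion "hypothesis at `u` ⇒
`trdeg ≥ l`" at a smaller exponent implies the one at a larger exponent: the criterion becomes
formally WEAKER as `u` grows. [this work] -/
theorem royHypothesis_anti_exponent {l : ℕ} {y α : Fin l → ℂ} {s₀ s₁ t₀ t₁ u u' : ℝ}
    (huu' : u' ≤ u) (h : RoyHypothesis y α s₀ s₁ t₀ t₁ u) :
    RoyHypothesis y α s₀ s₁ t₀ t₁ u' := by
  filter_upwards [h, eventually_ge_atTop 1] with N hN hN1
  obtain ⟨P, hP0, hd0, hd1, hH, hval⟩ := hN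
  refine ⟨P, hP0, hd0, hd1, hH, fun k m hk hm => (hval k m hk hm).trans ?_⟩
  have hx1 : (1 : ℝ) ≤ (N : ℝ) := by exact_mod_cast hN1
  have : (N : ℝ) ^ u' ≤ (N : ℝ) ^ u := Real.rpow_le_rpow_of_exponent_le hx1 huu'
  exact Real.exp_le_exp.2 (by linarith)

/-! ### Padé forms at exponent `v` ⇒ the hypothesis at `(y, e^y)`, for every `u < v` -/

/-- **Padé forms ⇒ Roy's hypothesis on the graph of `exp`, with no ceiling.**  Let
`0 < s₀ < u`, `0 ≤ s₁, t₀, t₁` and `max{1, t₀, s₁ + t₁, u} < v`.  If `P_N ≠ 0`,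
`deg P_N ≤ (N^{t₀}, N^{t₁})`, `H(P_N) ≤ e^N` and `taylorInt n P_N = 0` for all `n ≤ N^v` (all large
`N`), then the SAME sequence witnesses Roy's hypothesis for `(y, e^y)` at `(s₀, s₁, t₀, t₁, u)`, for
every `y ∈ ℂ^l`: `|(D^k P_N)(Σ m_j y_j, Π e^{m_j y_j})| ≤ e^{-N^u}`, `k ≤ N^{s₀}`, `m_j ≤ N^{s₁}`.
(`universal_of_pade` with `c = Σ |y_j|`, then Cauchy's inequalities on the unit circle about
`Σ m_j y_j` and `k! e^{-2N^u} ≤ e^{-N^u}`, the tree's `eventually_factorial_mul_exp_le`.)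
[this work; cite: Roy2001, §5 (2°)] -/
theorem royHypothesis_exp_of_padeExponent {l : ℕ} (y : Fin l → ℂ) {s₀ s₁ t₀ t₁ u v : ℝ}
    (hs₀ : 0 < s₀) (hs₀u : s₀ < u) (hs₁ : 0 ≤ s₁) (ht₀ : 0 ≤ t₀) (ht₁ : 0 ≤ t₁)
    (h1v : 1 < v) (ht₀v : t₀ < v) (hstv : s₁ + t₁ < v) (huv : u < v)
    (P : ℕ → MvPolynomial (Fin 2) ℤ)
    (hP : ∀ᶠ N : ℕ in atTop, P N ≠ 0 ∧
      ((P N).degreeOf 0 : ℝ) ≤ (N : ℝ) ^ t₀ ∧ ((P N).degreeOf 1 : ℝ) ≤ (N : ℝ) ^ t₁ ∧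
      (mvPolyHeight (P N) : ℝ) ≤ Real.exp N ∧
      ∀ n : ℕ, (n : ℝ) ≤ (N : ℝ) ^ v → taylorInt n (P N) = 0) :
    RoyHypothesis y (cexp ∘ y) s₀ s₁ t₀ t₁ u := by
  set c : ℝ := ∑ j, ‖y j‖ with hc_def
  have hc : 0 ≤ c := Finset.sum_nonneg fun j _ => norm_nonneg _
  filter_upwards [hP, eventually_factorial_mul_exp_le hs₀ hs₀u,
    universal_of_pade hs₁ ht₀ ht₁ h1v ht₀v hstv huv hc P (hP.mono fun N hN => hN.2)]
    with N hN hfact hval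
  obtain ⟨hP0, hd0, hd1, hH, -⟩ := hN
  refine ⟨P N, hP0, hd0, hd1, hH, fun k m hk hm => ?_⟩
  set z₀ : ℂ := ∑ j, (m j : ℂ) * y j with hz₀_def
  have hz₀ : ‖z₀‖ ≤ c * (N : ℝ) ^ s₁ := by
    calc ‖z₀‖ ≤ ∑ j, ‖(m j : ℂ) * y j‖ := norm_sum_le _ _
      _ ≤ ∑ j, (N : ℝ) ^ s₁ * ‖y j‖ := by
          refine Finset.sum_le_sum fun j _ => ?_
          rw [norm_mul, Complex.norm_natCast]
          exact mul_le_mul_of_nonneg_right (hm j) (norm_nonneg _)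
      _ = c * (N : ℝ) ^ s₁ := by rw [hc_def, Finset.sum_mul]; simp [mul_comm]
  have hpt : (![∑ j, (m j : ℂ) * y j, ∏ j, (cexp ∘ y) j ^ m j] : Fin 2 → ℂ) = ![z₀, cexp z₀] := by
    have : ∏ j, (cexp ∘ y) j ^ m j = cexp z₀ := by
      rw [hz₀_def, Complex.exp_sum]
      simp [Complex.exp_nat_mul]
    rw [this]
  have hsphere : ∀ z ∈ sphere z₀ 1, ‖expEval (P N) z‖ ≤ Real.exp (-(2 * (N : ℝ) ^ u)) := by
    intro z hz
    refine hval z ?_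
    have h1 : ‖z - z₀‖ = 1 := by simpa [dist_eq_norm] using hz
    calc ‖z‖ = ‖(z - z₀) + z₀‖ := by ring_nf
      _ ≤ ‖z - z₀‖ + ‖z₀‖ := norm_add_le _ _
      _ ≤ 1 + c * (N : ℝ) ^ s₁ := by rw [h1]; gcongr
  rw [hpt]
  calc ‖aeval ![z₀, cexp z₀] (royD^[k] (P N))‖ = ‖expEval (royD^[k] (P N)) z₀‖ := rfl
    _ ≤ k.factorial * Real.exp (-(2 * (N : ℝ) ^ u)) :=
        norm_expEval_iterate_royD_le k (P N) z₀ hsphere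
    _ ≤ Real.exp (-(N : ℝ) ^ u) := hfact k hk

/-- **The criterion below the Padé exponent implies Schanuel.**  If Padé forms exist at exponent
`v` and `0 < s₀ < u`, `0 ≤ s₁, t₀, t₁`, `max{1, t₀, s₁ + t₁, u} < v`, then Roy's criterion at
`(s₀, s₁, t₀, t₁, u)` in rank `l` implies `SchanuelRank l`, whatever the position of `u` relative to
Roy's ceiling `½(1 + t₀ + t₁)`. [this work] -/
theorem schanuelRank_of_royCriterionAt {l : ℕ} {s₀ s₁ t₀ t₁ u v : ℝ}
    (hs₀ : 0 < s₀) (hs₀u : s₀ < u) (hs₁ : 0 ≤ s₁) (ht₀ : 0 ≤ t₀) (ht₁ : 0 ≤ t₁)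
    (h1v : 1 < v) (ht₀v : t₀ < v) (hstv : s₁ + t₁ < v) (huv : u < v)
    (hPade : ∀ᶠ N : ℕ in atTop, ∃ P : MvPolynomial (Fin 2) ℤ, P ≠ 0 ∧
      (P.degreeOf 0 : ℝ) ≤ (N : ℝ) ^ t₀ ∧ (P.degreeOf 1 : ℝ) ≤ (N : ℝ) ^ t₁ ∧
      (mvPolyHeight P : ℝ) ≤ Real.exp N ∧
      ∀ n : ℕ, (n : ℝ) ≤ (N : ℝ) ^ v → taylorInt n P = 0)
    (hcrit : ∀ (y α : Fin l → ℂ), LinearIndependent ℚ y → (∀ j, α j ≠ 0) →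
      RoyHypothesis y α s₀ s₁ t₀ t₁ u →
        (l : Cardinal) ≤ Algebra.trdeg ℚ
          ↥(IntermediateField.adjoin ℚ (Set.range y ∪ Set.range α))) :
    SchanuelRank l := by
  classical
  intro y hy
  let good : ℕ → MvPolynomial (Fin 2) ℤ → Prop := fun N Q =>
    Q ≠ 0 ∧ (Q.degreeOf 0 : ℝ) ≤ (N : ℝ) ^ t₀ ∧ (Q.degreeOf 1 : ℝ) ≤ (N : ℝ) ^ t₁ ∧
      (mvPolyHeight Q : ℝ) ≤ Real.exp N ∧
      ∀ n : ℕ, (n : ℝ) ≤ (N : ℝ) ^ v → taylorInt n Q = 0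
  let P : ℕ → MvPolynomial (Fin 2) ℤ := fun N =>
    if hN : ∃ Q, good N Q then hN.choose else 0
  have hP : ∀ᶠ N : ℕ in atTop, good N (P N) := by
    filter_upwards [hPade] with N hN
    have hex : ∃ Q, good N Q := hN
    show good N (if hN : ∃ Q, good N Q then hN.choose else 0)
    rw [dif_pos hex]
    exact hex.choose_spec
  have h := hcrit y (cexp ∘ y) hy (fun j => Complex.exp_ne_zero _)
    (royHypothesis_exp_of_padeExponent y hs₀ hs₀u hs₁ ht₀ ht₁ h1v ht₀v hstv huv P hP)
  simpa [Set.range_comp] using h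

/-- **Roy's equivalence below the Padé existence exponent.**  Let `s₀, s₁, t₀, t₁, u > 0` with
`max{1, t₀, 2t₁} < min{s₀, 2s₁} < u` and `s₀ < u` (Proposition 3's range, with Roy's `s₀ < u`), and
suppose Padé forms exist at some exponent `v > max{s₁ + t₁, u}`.  Then
`SchanuelRank l ⟺` Roy's criterion in rank `l` at `(s₀, s₁, t₀, t₁, u)`.  No condition
`u < ½(1 + t₀ + t₁)` appears: the ceiling is replaced by the existence of Padé forms above `u`.
[this work] -/
theorem schanuelRank_iff_royCriterionAt {l : ℕ} {s₀ s₁ t₀ t₁ u v : ℝ}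
    (hs₀ : 0 < s₀) (hs₁ : 0 < s₁) (ht₀ : 0 < t₀) (ht₁ : 0 < t₁) (hu : 0 < u)
    (h1 : max 1 (max t₀ (2 * t₁)) < min s₀ (2 * s₁)) (h2 : min s₀ (2 * s₁) < u) (hs₀u : s₀ < u)
    (hstv : s₁ + t₁ < v) (huv : u < v)
    (hPade : ∀ᶠ N : ℕ in atTop, ∃ P : MvPolynomial (Fin 2) ℤ, P ≠ 0 ∧
      (P.degreeOf 0 : ℝ) ≤ (N : ℝ) ^ t₀ ∧ (P.degreeOf 1 : ℝ) ≤ (N : ℝ) ^ t₁ ∧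
      (mvPolyHeight P : ℝ) ≤ Real.exp N ∧
      ∀ n : ℕ, (n : ℝ) ≤ (N : ℝ) ^ v → taylorInt n P = 0) :
    SchanuelRank l ↔
      ∀ (y α : Fin l → ℂ), LinearIndependent ℚ y → (∀ j, α j ≠ 0) →
        RoyHypothesis y α s₀ s₁ t₀ t₁ u →
          (l : Cardinal) ≤ Algebra.trdeg ℚ
            ↥(IntermediateField.adjoin ℚ (Set.range y ∪ Set.range α)) := by
  have hMs₀ : max 1 (max t₀ (2 * t₁)) < s₀ := lt_of_lt_of_le h1 (min_le_left _ _)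
  have h1v : 1 < v := (lt_of_le_of_lt (le_max_left _ _) hMs₀).trans (hs₀u.trans huv)
  have ht₀v : t₀ < v :=
    (lt_of_le_of_lt ((le_max_left _ _).trans (le_max_right _ _)) hMs₀).trans (hs₀u.trans huv)
  exact ⟨fun hS y α hy hα hhyp => royCriterionAt_of_schanuelRank hS hs₀ hs₁ ht₀ ht₁ hu h1 h2
      y α hy hα hhyp,
    fun hcrit => schanuelRank_of_royCriterionAt hs₀ hs₀u hs₁.le ht₀.le ht₁.le h1v ht₀v hstv huv
      hPade hcrit⟩

/-! ### Bounds on the Padé existence exponent: `½(1 + t₀ + t₁) ≤ v* ≤ t₀ + t₁` -/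

/-- **Lower bound `v* ≥ ½(1 + t₀ + t₁)` (Siegel).**  For `t₀, t₁ > 0` and every `v` with
`max{1, t₀, 2t₁} < v`, `½ max{1, t₀, 2t₁} + t₁ < v` and `v < ½(1 + t₀ + t₁)`, Padé forms exist at
exponent `v`.  (Complete `(t₀, t₁, v)` to an admissible 5-tuple with `v` in the place of `u`, apply
the tree's `exists_padeSequence`; the two side conditions are inherited from the shape of Roy's
window and are not claimed to be necessary.) [this work; Siegel's lemma] -/
theorem exists_pade_of_lt_half {t₀ t₁ v : ℝ} (ht₀ : 0 < t₀) (ht₁ : 0 < t₁)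
    (hMv : max 1 (max t₀ (2 * t₁)) < v) (hMv' : max 1 (max t₀ (2 * t₁)) / 2 + t₁ < v)
    (hv : v < (1 + t₀ + t₁) / 2) :
    ∀ᶠ N : ℕ in atTop, ∃ P : MvPolynomial (Fin 2) ℤ, P ≠ 0 ∧
      (P.degreeOf 0 : ℝ) ≤ (N : ℝ) ^ t₀ ∧ (P.degreeOf 1 : ℝ) ≤ (N : ℝ) ^ t₁ ∧
      (mvPolyHeight P : ℝ) ≤ Real.exp N ∧
      ∀ n : ℕ, (n : ℝ) ≤ (N : ℝ) ^ v → taylorInt n P = 0 := by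
  set M : ℝ := max 1 (max t₀ (2 * t₁)) with hM
  have hM1 : 1 ≤ M := le_max_left _ _
  set s₀ : ℝ := (M + v) / 2 with hs₀
  set s₁ : ℝ := (M / 2 + (v - t₁)) / 2 with hs₁
  have hadm : RoyAdmissible s₀ s₁ t₀ t₁ v :=
    ⟨by rw [hs₀]; linarith, by rw [hs₁]; linarith, ht₀, ht₁, by linarith,
      lt_min (by rw [hs₀]; linarith) (by rw [hs₁]; linarith),
      max_lt (by rw [hs₀]; linarith) (by rw [hs₁]; linarith), hv⟩
  exact exists_padeSequence hadm

/-- **Upper bound `v* ≤ t₀ + t₁` (Hermite perfectness).**  For `t₀, t₁ ≥ 0` and `t₀ + t₁ < v`,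
eventually every non-zero `P` with `deg ≤ (N^{t₀}, N^{t₁})` has `taylorInt n P ≠ 0` for some
`n ≤ N^v`: no Padé forms exist at exponent `v`, whatever the height.  (`exists_taylorInt_ne_zero`
of `SoloBlindHermitePerfect`: the contact is `< (T₀+1)(T₁+1) ≤ N^v`.) [this work; folklore] -/
theorem eventually_exists_taylorInt_ne_zero_of_lt {t₀ t₁ v : ℝ} (ht₀ : 0 ≤ t₀) (ht₁ : 0 ≤ t₁)
    (hv : t₀ + t₁ < v) :
    ∀ᶠ N : ℕ in atTop, ∀ P : MvPolynomial (Fin 2) ℤ, P ≠ 0 →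
      (P.degreeOf 0 : ℝ) ≤ (N : ℝ) ^ t₀ → (P.degreeOf 1 : ℝ) ≤ (N : ℝ) ^ t₁ →
        ∃ n : ℕ, (n : ℝ) ≤ (N : ℝ) ^ v ∧ taylorInt n P ≠ 0 := by
  have H : ∀ᶠ x : ℝ in atTop, (x ^ t₀ + 1) * (x ^ t₁ + 1) ≤ x ^ v := by
    filter_upwards [eventually_ge_atTop (1 : ℝ), eventually_mul_rpow_le_mul_rpow 4 hv one_pos]
      with x hx1 E
    have hx0 : 0 < x := one_pos.trans_le hx1
    have h0 : 1 ≤ x ^ t₀ := Real.one_le_rpow hx1 ht₀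
    have h1 : 1 ≤ x ^ t₁ := Real.one_le_rpow hx1 ht₁
    calc (x ^ t₀ + 1) * (x ^ t₁ + 1) ≤ (2 * x ^ t₀) * (2 * x ^ t₁) := by
          apply mul_le_mul (by linarith) (by linarith) (by positivity) (by positivity)
      _ = 4 * x ^ (t₀ + t₁) := by rw [Real.rpow_add hx0]; ring
      _ ≤ 1 * x ^ v := E
      _ = x ^ v := one_mul _
  filter_upwards [tendsto_natCast_atTop_atTop.eventually H] with N hN P hP0 hd0 hd1
  obtain ⟨n, hn, hne⟩ := exists_taylorInt_ne_zero P hP0 le_rfl le_rfl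
  refine ⟨n, ?_, hne⟩
  have hlt : (n : ℝ) < ((P.degreeOf 0 : ℝ) + 1) * ((P.degreeOf 1 : ℝ) + 1) := by
    exact_mod_cast hn
  have hle : ((P.degreeOf 0 : ℝ) + 1) * ((P.degreeOf 1 : ℝ) + 1) ≤
      ((N : ℝ) ^ t₀ + 1) * ((N : ℝ) ^ t₁ + 1) := by
    apply mul_le_mul (by linarith) (by linarith) (by positivity) (by positivity)
  linarith

/-- **Above `t₀ + t₁` the hypothesis is empty at every point.**  For `t₀, t₁ ≥ 0` and
`t₀ + t₁ < s₀`, Roy's hypothesis at `(s₀, s₁, t₀, t₁, u)` fails for EVERY `(y, α)` (any `s₁`, any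
`u`): at `m = 0` it would make the integers `taylorInt k P_N = (D^k P_N)(0, 1)`, `k ≤ N^{s₀}`, of
absolute value `≤ e^{-N^u} < 1`, hence zero, against perfectness. [this work] -/
theorem not_royHypothesis_of_lt {l : ℕ} (y α : Fin l → ℂ) {s₀ s₁ t₀ t₁ u : ℝ}
    (ht₀ : 0 ≤ t₀) (ht₁ : 0 ≤ t₁) (h : t₀ + t₁ < s₀) :
    ¬ RoyHypothesis y α s₀ s₁ t₀ t₁ u := by
  intro hhyp
  have hboth := (hhyp.and ((eventually_exists_taylorInt_ne_zero_of_lt ht₀ ht₁ h).and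
    (eventually_gt_atTop 0)))
  obtain ⟨N, ⟨P, hP0, hd0, hd1, -, hval⟩, hperf, hN0⟩ := hboth.exists
  obtain ⟨n, hn, hne⟩ := hperf P hP0 hd0 hd1
  have hm : ∀ j, (((0 : Fin l → ℕ) j : ℕ) : ℝ) ≤ (N : ℝ) ^ s₁ := fun j => by
    simpa using Real.rpow_nonneg (Nat.cast_nonneg N) s₁
  have hsmall := hval n 0 hn hm
  have hpt : (![∑ j, (((0 : Fin l → ℕ) j : ℕ) : ℂ) * y j, ∏ j, α j ^ (0 : Fin l → ℕ) j] :
      Fin 2 → ℂ) = ![0, 1] := by simp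
  rw [hpt] at hsmall
  have hcast : (taylorInt n P : ℂ) = aeval ![(0 : ℂ), 1] (royD^[n] P) := by
    rw [taylorInt_cast, iteratedDeriv_expEval, expEval_apply, Complex.exp_zero]
  have hNpos : (0 : ℝ) < N := by exact_mod_cast hN0
  have hlt1 : ‖(taylorInt n P : ℂ)‖ < 1 := by
    rw [hcast]
    refine hsmall.trans_lt ?_
    calc Real.exp (-(N : ℝ) ^ u) < Real.exp 0 :=
          Real.exp_lt_exp.2 (neg_lt_zero.2 (Real.rpow_pos_of_pos hNpos u))
      _ = 1 := Real.exp_zero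
  rw [Complex.norm_intCast] at hlt1
  exact hne (Int.abs_lt_one_iff.1 (by exact_mod_cast hlt1))

/-- Consequently, for `t₀ + t₁ < s₀` Roy's criterion at `(s₀, s₁, t₀, t₁, u)` holds VACUOUSLY in
every rank `l`: above the perfectness exponent the criterion is equivalent to nothing.  Roy's window
(`s₀ < u < ½(1+t₀+t₁) < t₀ + t₁`) stays below this regime; between the two lies the Padé existence
exponent `v*`. [this work] -/
theorem royCriterionAt_of_lt_s₀ (l : ℕ) {s₀ s₁ t₀ t₁ u : ℝ}
    (ht₀ : 0 ≤ t₀) (ht₁ : 0 ≤ t₁) (h : t₀ + t₁ < s₀) :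
    ∀ (y α : Fin l → ℂ), LinearIndependent ℚ y → (∀ j, α j ≠ 0) →
      RoyHypothesis y α s₀ s₁ t₀ t₁ u →
        (l : Cardinal) ≤ Algebra.trdeg ℚ
          ↥(IntermediateField.adjoin ℚ (Set.range y ∪ Set.range α)) :=
  fun y α _ _ hhyp => absurd hhyp (not_royHypothesis_of_lt y α ht₀ ht₁ h)

/-- **Roy's theorem recovered as the case `v < ½(1 + t₀ + t₁)`.**  For an admissible 5-tuple the
equivalence `SchanuelRank l ⟺` criterion at that tuple follows from
`schanuelRank_iff_royCriterionAt` with a Padé exponent `v ∈ (u, ½(1+t₀+t₁))` supplied by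
`exists_pade_of_lt_half`. [this work; cite: Roy2001, §5] -/
theorem schanuelRank_iff_royCriterionAt_of_admissible {l : ℕ} {s₀ s₁ t₀ t₁ u : ℝ}
    (hadm : RoyAdmissible s₀ s₁ t₀ t₁ u) :
    SchanuelRank l ↔
      ∀ (y α : Fin l → ℂ), LinearIndependent ℚ y → (∀ j, α j ≠ 0) →
        RoyHypothesis y α s₀ s₁ t₀ t₁ u →
          (l : Cardinal) ≤ Algebra.trdeg ℚ
            ↥(IntermediateField.adjoin ℚ (Set.range y ∪ Set.range α)) := by
  obtain ⟨hs₀, hs₁, ht₀, ht₁, hu, h1, h2, h3⟩ := hadm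
  have hs₀u : s₀ < u := lt_of_le_of_lt (le_max_left _ _) h2
  have hst : s₁ + t₁ < u := lt_of_le_of_lt (le_max_right _ _) h2
  have hmin : min s₀ (2 * s₁) < u := lt_of_le_of_lt (min_le_left _ _) hs₀u
  set v : ℝ := (u + (1 + t₀ + t₁) / 2) / 2 with hv
  have huv : u < v := by rw [hv]; linarith
  have hv3 : v < (1 + t₀ + t₁) / 2 := by rw [hv]; linarith
  have hMu : max 1 (max t₀ (2 * t₁)) < u := h1.trans hmin
  have hMv : max 1 (max t₀ (2 * t₁)) < v := hMu.trans huv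
  have hMv' : max 1 (max t₀ (2 * t₁)) / 2 + t₁ < v := by
    have h2s₁ : max 1 (max t₀ (2 * t₁)) < 2 * s₁ := lt_of_lt_of_le h1 (min_le_right _ _)
    linarith
  exact schanuelRank_iff_royCriterionAt hs₀ hs₁ ht₀ ht₁ hu h1 hmin hs₀u (hst.trans huv) huv
    (exists_pade_of_lt_half ht₀ ht₁ hMv hMv' hv3)

end Summit.Schanuel.Schanuel.Theorems

end
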